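import Summits.ResolutionOfSingularities.ResolutionOfSingularities.Theorems.EquisingularLiftEquisingularLiftNatGoodAtOfFlatModel
import Summits.ResolutionOfSingularities.ResolutionOfSingularities.Theorems.EquisingularLiftEquisingularLiftResolveOnePointDimOne
import Literature.AlgebraicGeometry.Resolution.SpreadRestrict
import Literature.AlgebraicGeometry.Resolution.PointBlowupHsFunMono
import HarnessLib

/-!
# [OURS · L1 W4.5(b) · EL♮(3)] HSUB(ReachTC⁺) — THE IN-CARRIER SECTION: a section of the stage THROUGH a regular point of the
# running curve and ON the in-carrier surface `D = V(C)` (registered stub `stub_elnat_tcPlusPointResolution`; driver p526242, brick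
# `inv_step_regular`, step 1 of 3)

Crux `EquisingularLiftNat` = stmt-ResolutionOfSingularities-20038 (child EL♮(3) = stmt-ResolutionOfSingularities-20148), route
EquisingularLift, line `sections`. Helper file `--supports stmt-ResolutionOfSingularities-20148 --as helper` by res-L1-w45b-stub-1
(HSUB(ReachTC⁺) assembly, res-L1-w45b-lead-2 GO 2026-08-27T10:45:46Z). HONEST FRAMING: OURS (cell res-hironaka, slot W4.5(b)); NOT a
statement of any manuscript; AI-written, weaker than expert review. No `sorry`; standard axioms.

WHAT. res-L1-w45b-lead-2's TARGET-TCPLUS «Hensel sections ON `V(G̃)` at the regular points»: in the model-square currency of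
res-D-pv-029's K5′, for a stage `r : X → Spec O` with model `jG : G → X` (`IsPullback jG tG r (Spec θ)`) and an in-carrier centre
candidate `C` (for v7 (TC⁺): `C = St(𝓢) ⊔ St(K)`) with `V(C) → Spec O` FLAT, a CLOSED point `y ∈ G` with `jG y ∈ supp C` at which
(a) the quotient stalk `𝒪_{X, jG y} / C_{jG y}` is regular and (b) the special fibre `V(C · 𝒪_G)` is regular — there is a SECTION `s`
of `r` with `s(𝔪) = jG y` and `C ≤ ker s` (the section lies ON `V(C)`), whose centre `V(ker s)` is regular and `O`-flat.

* `exists_inCarrier_section` — proof: the model square of `V(C)` is the pull-back of `jG` along `V(C) ↪ X` (tree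
  `isPullback_subschemeMap`, pasted with the stage's square), `V(C) → Spec O` is flat / separated / locally of finite presentation, so
  …NatGoodAtOfFlatModel's `exists_section_of_model_of_isRegularLocalRing` (p527131) gives a section `s_D` of `V(C)`; then
  `s := s_D ≫ V(C).ι` and `C = ker V(C).ι ≤ ker s` (Mathlib `Hom.le_ker_comp`), centre facts by the tree's
  `section_isClosedImmersion_and_isRegular_ker` / `flat_kerSubschemeι_comp_of_section`.

References: res-D-pv-029 K5′ / `modelStep_chain`; tree `exists_section_of_goodAt`, `isPullback_subschemeMap`,
`isRegularLocalRing_stalk_subscheme_iff`; EGA IV 18.5.17.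
-/

set_option linter.dupNamespace false -- mandated namespace `Summit.<Summit>.<Problem>` of this single-conjunct summit
set_option linter.overlappingInstances false -- signatures carry `[IsDomain O] [IsDiscreteValuationRing O]`

noncomputable section

open CategoryTheory CategoryTheory.Limits AlgebraicGeometry TopologicalSpace Topology IsLocalRing
open Literature.AlgebraicGeometry.Resolution
open AlgebraicGeometry.Scheme.IdealSheafData
open Summit.ResolutionOfSingularities.ResolutionOfSingularities.Theses.EquisingularLift.Split
open Summit.ResolutionOfSingularities.ResolutionOfSingularities.Cruxes.EquisingularLift.StrataSplit

namespace Summit.ResolutionOfSingularities.ResolutionOfSingularities.Cruxes.EquisingularLiftNat.Sections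

/-- **The in-carrier section through a regular point of the running curve.** See the module docstring.
[cite: Grothendieck1967, Thm. 18.5.17] [OURS · L1 W4.5b] toward `stub_elnat_tcPlusPointResolution`; NOT a statement of the manuscript. -/
theorem exists_inCarrier_section (O : Type) [CommRing O] [IsDomain O] [IsDiscreteValuationRing O]
    [IsAdicComplete (maximalIdeal O) O] [IsAlgClosed (ResidueField O)] (k : Type) [Field k]
    (θ : O →+* k) (hθ : Function.Surjective θ) (X G : Scheme.{0}) [IsLocallyNoetherian X] (r : X ⟶ Spec (.of O))
    [IsSeparated r] [LocallyOfFiniteType r]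
    (jG : G ⟶ X) (tG : G ⟶ Spec (.of k)) (hsq : IsPullback jG tG r (Spec.map (CommRingCat.ofHom θ)))
    (C : X.IdealSheafData) (hCflat : Flat (C.subschemeι ≫ r)) (y : G) (hycl : IsClosed ({y} : Set G))
    (hyC : jG y ∈ (C.support : Set X))
    (hreg : IsRegularLocalRing (X.presheaf.stalk (jG y) ⧸ stalkIdeal C (jG y)))
    (hfib : ∀ y' : ↥(C.comap jG).subscheme, (C.comap jG).subschemeι y' = y →
      IsRegularLocalRing ((C.comap jG).subscheme.presheaf.stalk y')) :
    ∃ s : Spec (.of O) ⟶ X, s ≫ r = 𝟙 _ ∧ s (closedPoint O) = jG y ∧ C ≤ s.ker ∧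
      Scheme.IsRegular s.ker.subscheme ∧ Flat (s.ker.subschemeι ≫ r) := by
  haveI := hCflat
  -- the model square of `V(C)`: the pull-back of `jG` along `V(C) ↪ X`, pasted with the stage's square
  have hsqC : IsPullback (subschemeMap (C.comap jG) C jG (C.le_map_comap jG)) ((C.comap jG).subschemeι ≫ tG)
      (C.subschemeι ≫ r) (Spec.map (CommRingCat.ofHom θ)) :=
    (isPullback_subschemeMap jG C).paste_vert hsq
  -- the point of `V(C · 𝒪_G)` over `y`
  have hy' : y ∈ Set.range (C.comap jG).subschemeι := by
    rw [range_subschemeι, Scheme.IdealSheafData.support_comap]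
    exact hyC
  obtain ⟨y', hy'y⟩ := hy'
  have hy'cl : IsClosed ({y'} : Set ↥(C.comap jG).subscheme) := by
    have h : ({y'} : Set ↥(C.comap jG).subscheme) = (C.comap jG).subschemeι ⁻¹' {y} := by
      ext z
      simp only [Set.mem_singleton_iff, Set.mem_preimage]
      constructor
      · rintro rfl; exact hy'y
      · intro hz
        exact (C.comap jG).subschemeι.isClosedEmbedding.injective (hz.trans hy'y.symm)
    rw [h]
    exact hycl.preimage (C.comap jG).subschemeι.continuous
  -- the image of `y'` in `V(C)` lies over `jG y`
  have hjy' : C.subschemeι (subschemeMap (C.comap jG) C jG (C.le_map_comap jG) y') = jG y := by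
    rw [← Scheme.Hom.comp_apply, subschemeMap_subschemeι, Scheme.Hom.comp_apply, hy'y]
  -- regularity of `V(C)` at that point, read on the quotient stalk
  have hregD : IsRegularLocalRing (C.subscheme.presheaf.stalk (subschemeMap (C.comap jG) C jG (C.le_map_comap jG) y')) := by
    rw [isRegularLocalRing_stalk_subscheme_iff]
    have h := hjy'
    change C.subschemeι.base _ = jG y at h
    rw [h]
    exact hreg
  -- `V(C) → Spec O` is flat, separated, locally of finite presentation
  haveI : IsSeparated (C.subschemeι ≫ r) := inferInstance
  haveI : LocallyOfFiniteType (C.subschemeι ≫ r) := inferInstance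
  haveI : LocallyOfFinitePresentation (C.subschemeι ≫ r) := locallyOfFinitePresentation_of_isLocallyNoetherian' _
  -- the Hensel section on `V(C)`
  obtain ⟨sD, hsD, hsDpt, -, -, -⟩ := exists_section_of_model_of_isRegularLocalRing O k θ hθ C.subscheme
    (C.comap jG).subscheme (C.subschemeι ≫ r) (subschemeMap (C.comap jG) C jG (C.le_map_comap jG))
    ((C.comap jG).subschemeι ≫ tG) hsqC y' hy'cl hregD (hfib y' hy'y)
  refine ⟨sD ≫ C.subschemeι, by rw [Category.assoc, hsD], ?_, ?_, ?_, ?_⟩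
  · rw [Scheme.Hom.comp_apply, hsDpt, hjy']
  · calc C = C.subschemeι.ker := (ker_subschemeι C).symm
      _ ≤ (sD ≫ C.subschemeι).ker := sD.le_ker_comp C.subschemeι
  · exact (section_isClosedImmersion_and_isRegular_ker O X r (sD ≫ C.subschemeι) (by rw [Category.assoc, hsD])).2.1
  · exact flat_kerSubschemeι_comp_of_section O r (sD ≫ C.subschemeι) (by rw [Category.assoc, hsD])

end Summit.ResolutionOfSingularities.ResolutionOfSingularities.Cruxes.EquisingularLiftNat.Sections

end
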